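/-
Copyright (c) 2026. All rights reserved.
Released under Apache 2.0 license as described in the file LICENSE.
-/
import Literature.NumberTheory.Weil1964.ArchFollandDualPair
import Literature.NumberTheory.Weil1964.ArchLeviKAKInput
import Literature.NumberTheory.Weil1964.ArchSectionThetaMajorants
import Literature.NumberTheory.GelbartRogawski1991.UnitaryDualPairThetaKernelCM
import HarnessLib

-- buildfix G11b-3 recipe (LEDGER B13-1/B13-3): elaborate sequentially so the trailing `attribute [implicit_reducible]`
-- block (reducibilityCoreExt is keyed to the async environment branch) is in force at `.olean` export.
set_option Elab.async false

/-!
# Weil's theta majorants for the adelic unitary dual pair `U(V) × U(W) ⊂ Mp(𝕎_𝔸)`, `𝕎 = Res_{E/F}(V ⊗_E W)`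

[Weil1964] A. Weil, *Sur certains groupes d'opérateurs unitaires*, Acta Math. 111 (1964) 143–211, Chap. III n° 41:
Lemme 5 p. 194 and Théorème 6 (1) p. 193 — for `Φ ∈ 𝒮(X_𝔸)` and `s` ranging over a compact subset of `Mp(𝔸)`, the
functions `ω(s)Φ` are uniformly majorised by some `Φ₀ ∈ 𝒮(X_𝔸)`; in the tree this is the hypothesis-free predicate
`HasThetaMajorants` of `Weil1964.AdelicMetaplecticThetaMajorants`, delivered for a continuous homomorphism
`s : H → Mp_ψ(𝕎_𝔸)ᶜᵒⁿᵗ` by `hasThetaMajorants_omega_comp_of_kakData` (`Weil1964.ArchSectionThetaMajorants`) from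
ONE archimedean input: `KAK` implementer data for a real phase-space action `γ : G → PhaseMap σ` together with the
DICTIONARY `archPhaseMap 𝕋 e (π(s h)) = γ (ϖ h)` identifying, in a real frame `e` of `F_∞ⁿ`, the archimedean
symplectic action of `π(s h)` with `γ`.

This file discharges that input for the unitary dual pair of [GelbartRogawski1991] §3.1 p. 454–455 with DIAGONAL
hermitian forms `J_V = diag(t_V) ⊗ 1`, `J_W = diag(t_W) ⊗ 1` over a quadratic extension `E/F` of a totally real
field (in particular a CM field over its maximal real subfield):

* `archPhaseMap_toSp_pair` — THE DICTIONARY: in the scaled Folland frame `e_D` of `𝕎_∞ = ⊕_v 𝕎_v`,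
  `D = D_V ⊗ D_W` adapted place by place (`Weil1964.ArchFollandDualPair`), the archimedean action of
  `ι(u₁ ⊗ 1 · 1 ⊗ u₂) ∈ Sp(𝕎_𝔸)` is the slice-by-slice phase map
  `placePhase (v ↦ reindexPhase (pairFrame e ε_V ε_W) (ι𝕎 (u₁,ᵥ, u₂,ᵥ)))` of Konno–Konno's real unitary dual pairs
  `ι𝕎 : U(P_v,Q_v) × U(R_v,S_v) → Sp(𝕎_v)` ([KonnoKonno2007] §3.1 (3.1); [MoeglinVignerasWaldspurger1987] Ch. 1
  I.17), `(u₁,ᵥ, u₂,ᵥ) = archPairPlace v (u₁, u₂)` the Sylvester images of the `v`-components;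
* `hasThetaMajorants_omega_pairSplitting` — THE MAJORANTS: for every family of Levi-form `KAK` inputs
  `I v : LeviKAKInput γ𝕎ᵥ κ_v a_v` of the real pairs (`Weil1964.ArchLeviKAKInput`: `.junction`, `.junctionSwap`,
  `.junctionCompact`, …) and every continuous COMPATIBLE splitting `s` ([GelbartRogawski1991] (3.1.1)–(3.1.2)),
  the family `(u₁, u₂) ↦ ω_ψ(s_pair(u₁, u₂))` `HasThetaMajorants`;
* `hasThetaMajorants_cmPairSplitting` — the same at the CM data of
  `GelbartRogawski1991.UnitaryDualPairThetaKernelCM` (`F = L⁺`, `E = L`, `c` = complex conjugation,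
  `T_V = diag(d_V)`, `T_W = diag(d_W)`, the chosen compatible splitting `cmPairSplitting`): LITERALLY the
  hypothesis `hρ` of `cmThetaKernelDatum`, from per-place sign frames / adapted scalings of `σ_v(d_V)`, `σ_v(d_W)`
  and per-place Levi-form `KAK` inputs;
* `hasThetaMajorants_cmPairSplitting_canonical` (and `hasThetaMajorants_omega_pairSplitting_canonical`) — the same
  with the frames and scalings CHOSEN (`signSplit`, `sqrtAbs` of `placeSignVec`): the consumer supplies a
  nowhere-zero sign convention `c_V` and, per real place, `Nonempty (AnyLeviKAKInput γ𝕎ᵥ)` for the resulting real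
  pair — which §0 provides from SIGN FACTS alone in the rank profiles the tree covers
  (`nonempty_anyLeviKAKInput_of_signs_left` : first factor of real rank `≤ 1`, second definite;
  `nonempty_anyLeviKAKInput_of_signs_right` : first factor definite, second of real rank `≤ 1` or negative definite);
* `hasThetaMajorants_cmPairSplitting_of_signs` (+ `_two` for a hermitian plane `W`, `M = 2`) — THE CONSUMER'S FORM:
  the sign convention is chosen inside and the input is SIGN FACTS THROUGH COMPLEX EMBEDDINGS only — through a
  distinguished `ι₁ : L →+* ℂ`, all but one of the `re ι₁(d_V i)` of a common strict sign and the `re ι₁(d_W j)` of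
  a common strict sign; through every `τ` at another place, the `re τ(d_V i)` of a common strict sign (and, for
  general `M`, all but at most one `re τ(d_W j)` positive or all negative — automatic for `M = 2`).  NOT covered by
  the tree's Levi-form `KAK` kinds (hence a hypothesis here, not a gap in Weil's n° 41): both factors of positive
  real rank at the same place, e.g. `U(2,1) × U(1,1)`.

Everything is proved; the only cited inputs are the ones already carried by the imported files (Weil's n° 41 is
the CONTENT of `HasThetaMajorants`' consumer, not a hypothesis here).

## Main statements

* `AnyLeviKAKInput` (kind-erased Levi-form `KAK` input), `nonempty_anyLeviKAKInput_of_card_le_one` /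
  `_of_compact_left` / `_of_signs_left` / `_of_signs_right` (the rank profiles `LeviKAKInput.junction` /
  `.junctionSwap` / `.junctionCompact` cover); `PosIdx`, `NegIdx`, `signSplit`, `sqrtAbs`, `placeSignVec`
  (canonical sign frames and adapted scalings).
* `cmPlaceOver` (+ `cmPlaceOver_smul`, `cmPlaceOver_comap`, `cmPlaceOver_eq_mk`): THE complex place of the CM
  field over each real place of `L⁺`, fixed by complex conjugation; bridges to the consumer's own complex
  embeddings `τ` over `v`: `embedding_algebraMap_eq_embedding_of_isReal`, `embedding_of_isReal_cmRealVec`,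
  `placeSignVec_cmRealVec` (`= re τ(dᵢ) / c_v`), `im_embedding_cmPlaceOver_eq_or` (`im` agrees with `im τ` up to
  sign), `im_embedding_cmPlaceOver_imagUnit_ne_zero`.
* `archPhaseMap_toSp_pair`, `hasThetaMajorants_omega_pairSplitting` (+ `_of_nonempty`, `_canonical`),
  `hasThetaMajorants_cmPairSplitting` (+ `_of_nonempty`, `_canonical`, `_of_signs`, `_of_signs_two`);
  `cmSignConv`, `nonempty_anyLeviKAKInput_cmSignConv`, `re_apply_ne_zero_of_complexConj_eq`, `signs_fin_two`,
  `forall_pos_or_forall_neg_div` (sign bookkeeping of the consumer's form).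

## Dependencies

Mathlib: `NumberField.InfinitePlace.comap_surjective`, `IsTotallyComplex.isComplex`, `NumberField.IsCMField`.
Tree: `Weil1964.ArchFollandDualPair` (`archFolland_archAct_toSp_pair_slice`, `archPairPlace`,
`continuous_archPairPlace_pi`, `pairFrame`, `pairScale`, `signOf`), `Weil1964.ArchLeviKAKInput` (`LeviKAKInput`,
`kakImplementerData_leviFamily_places_reindex`), `Weil1964.ArchVacuumSectionPlaces` (`placePhase`,
`placePhase_fst`, `placePhase_snd`), `Weil1964.ArchSectionThetaMajorants` (`hasThetaMajorants_omega_comp_of_kakData`),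
`Weil1964.ArchFollandCoordinates` (`archPhaseMap`, `archFolland_bijective`, `archPhaseMap_archFolland`,
`isUnit_archMat_of_isUnit`), `Weil1964.ArchFollandTorusAdelic` (`scaledFrame`),
`GelbartRogawski1991.UnitaryDualPairSplittingDatum` / `…ThetaKernel` / `…ThetaKernelCM` / `…GramDiagonal`
(`adelicGram`, `toSp`, `splittingDatum`, `pairSplitting`, `proj_pairSplitting`, `continuous_pairSplitting`,
`splittingOf`, `cmPairSplitting`, `realDiagonal`, `imagUnit`, `isUnit_adelicGram`),
`KonnoKonno2007.RealUnitaryDualPair` (`Ginf`, `ι𝕎`), `KonnoKonno2007.JunctionVacuumSectionSwap` (`reindexPhase`),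
`Automorphic.UnitaryGroupArchimedean` (`complexConj_smul_infinitePlace`).

## References

* [Weil1964] A. Weil, *Sur certains groupes d'opérateurs unitaires*, Acta Math. 111 (1964), Chap. III n° 41,
  Lemme 5 p. 194, Théorème 6 (1) p. 193 (doi:10.1007/BF02391012).
* [GelbartRogawski1991] S. Gelbart, J. Rogawski, *L-functions and Fourier–Jacobi coefficients for the unitary
  group U(3)*, Invent. Math. 105 (1991), §3.1 p. 454–455, Prop. 3.1.1.
* [KonnoKonno2007] K. Konno, T. Konno, *On doubling construction for real unitary dual pairs*, Kyushu J. Math. 61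
  (2007), §3.1 (3.1).
* [MoeglinVignerasWaldspurger1987] C. Mœglin, M.-F. Vignéras, J.-L. Waldspurger, *Correspondances de Howe sur un
  corps p-adique*, LNM 1291 (1987), Ch. 1 I.17.
* [Folland1989] G. B. Folland, *Harmonic Analysis in Phase Space*, Princeton UP (1989), Ch. 4 §1 Prop. (4.6)
  p. 151; §4.2 (4.24) p. 156, Prop. (4.39).

## Provenance

LEAN-IN-TREE rule (2026-08-18), pub-hodgecm model-construction sub-cell, lane mc-weil-2 gen 5 (MODEL-DAG node
W2-wm.maj, PIN half, J-SCOPE §2e).  KERNEL only: no records, no `sorry`, no new cited facts.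
-/

noncomputable section

open scoped Matrix Real Classical ComplexConjugate Kronecker
open Complex NumberField NumberField.InfinitePlace NumberField.mixedEmbedding IsDedekindDomain
open Literature.NumberTheory.Automorphic Literature.NumberTheory.Automorphic.UnitaryGroup
open Literature.RepresentationTheory.HeisenbergGroup Literature.Analysis.SegalBargmann
open Literature.RepresentationTheory.KonnoKonno2007 Literature.RepresentationTheory.KonnoKonno2007.RealDualPair

namespace Literature.NumberTheory.Weil1964

local notation "PV" σ => (σ → ℝ) × (σ → ℝ)

-- Notation (NOT a definition), as in `ArchLeviKAKInput` / `JunctionVacuumSection`: the archimedean symplectic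
-- action of `G_∞ = U(P,Q) × U(R,S)` on the polarised phase space, as phase maps.
set_option quotPrecheck false in
local notation "γ𝕎[" P ", " Q ", " R ", " S "]" =>
  fun g : Ginf P Q R S => (⇑((ι𝕎 P Q R S g).1 : (PV (DPIdx P Q R S)) ≃ₗ[ℝ] PV (DPIdx P Q R S)) :
    PhaseMap (DPIdx P Q R S))


/-! ## §0 Kind-erased Levi-form `KAK` inputs and the rank profiles the tree provides -/

section AnyInput

variable {σ : Type*} [Fintype σ] [DecidableEq σ] {G : Type*} [Monoid G] [TopologicalSpace G]

/-- **A Levi-form `KAK` input with its parameter spaces bundled**: compact generators `κ : K → G` and `A`-part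
`a : P → G` (with their topologies) together with `LeviKAKInput γ κ a`.  The pin theorems below only need ONE
such input per real place, of a KIND that varies with the place (`.junction` / `.junctionSwap` /
`.junctionCompact`); bundling the kinds lets the consumer supply `Nonempty (AnyLeviKAKInput γᵥ)` place by place,
by cases, inside a proof. [cite: Folland1989, §4.2 (4.24) p. 156, Prop. (4.39); Knapp2002, Thm 7.39] -/
structure AnyLeviKAKInput (γ : G → PhaseMap σ) : Type _ where
  /-- parameter space of the compact generators -/
  K : Type
  /-- parameter space of the `A`-part -/
  P : Type
  [topK : TopologicalSpace K]
  [topP : TopologicalSpace P]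
  /-- the compact generators -/
  κ : K → G
  /-- the `A`-part -/
  a : P → G
  /-- the Levi-form `KAK` input proper -/
  input : LeviKAKInput γ κ a

attribute [instance] AnyLeviKAKInput.topK AnyLeviKAKInput.topP

end AnyInput

section RealPairKinds

variable {P Q R S : Type} [Fintype P] [DecidableEq P] [Fintype Q] [DecidableEq Q] [Fintype R] [DecidableEq R]
  [Fintype S] [DecidableEq S]

/-- **Rank profile (J1): first factor of real rank `≤ 1` (`|Q| ≤ 1`), second factor compact (`R` or `S` empty)** —
the tree has a Levi-form `KAK` input: `LeviKAKInput.junction` if `P`, `Q` are inhabited, else both factors are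
compact and `LeviKAKInput.junctionCompact` applies (`UForm.kV_surjective_of_isEmpty_left/right`).
[cite: KonnoKonno2007, §3.1 (3.1); Folland1989, §4.2 (4.24) p. 156, Prop. (4.39); Knapp2002, Thm 7.39] -/
theorem nonempty_anyLeviKAKInput_of_card_le_one (hQ : Fintype.card Q ≤ 1) (hRS : IsEmpty R ∨ IsEmpty S) :
    Nonempty (AnyLeviKAKInput (γ𝕎[P, Q, R, S])) := by
  have hW : Function.Surjective (UForm.kV R S) := hRS.elim (fun _ => UForm.kV_surjective_of_isEmpty_left)
    fun _ => UForm.kV_surjective_of_isEmpty_right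
  haveI : Subsingleton Q := Fintype.card_le_one_iff_subsingleton.mp hQ
  rcases isEmpty_or_nonempty Q with _ | ⟨⟨q₀⟩⟩
  · exact ⟨⟨DPK P Q R S, PUnit, κ P Q R S, _,
      LeviKAKInput.junctionCompact UForm.kV_surjective_of_isEmpty_right hW⟩⟩
  · rcases isEmpty_or_nonempty P with _ | ⟨⟨p₀⟩⟩
    · exact ⟨⟨DPK P Q R S, PUnit, κ P Q R S, _,
        LeviKAKInput.junctionCompact UForm.kV_surjective_of_isEmpty_left hW⟩⟩
    · exact ⟨⟨DPK P Q R S, ℝ, κ P Q R S, _, LeviKAKInput.junction p₀ q₀ hW⟩⟩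

/-- **Rank profile (J2): first factor compact (`P` or `Q` empty), second factor of real rank `≤ 1` (`|S| ≤ 1`) or
compact with `R` empty** — `LeviKAKInput.junctionSwap` if `R`, `S` are inhabited, else `LeviKAKInput.junctionCompact`.
[cite: MoeglinVignerasWaldspurger1987, Ch. 1 I.17; KonnoKonno2007, §3.1 (3.1); Folland1989, §4.2 (4.24) p. 156,
Prop. (4.39); Knapp2002, Thm 7.39] -/
theorem nonempty_anyLeviKAKInput_of_compact_left (hPQ : IsEmpty P ∨ IsEmpty Q)
    (hS : Fintype.card S ≤ 1 ∨ IsEmpty R) : Nonempty (AnyLeviKAKInput (γ𝕎[P, Q, R, S])) := by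
  have hV : Function.Surjective (UForm.kV P Q) := hPQ.elim (fun _ => UForm.kV_surjective_of_isEmpty_left)
    fun _ => UForm.kV_surjective_of_isEmpty_right
  rcases hS with hS | _
  · haveI : Subsingleton S := Fintype.card_le_one_iff_subsingleton.mp hS
    rcases isEmpty_or_nonempty S with _ | ⟨⟨s₀⟩⟩
    · exact ⟨⟨DPK P Q R S, PUnit, κ P Q R S, _,
        LeviKAKInput.junctionCompact hV UForm.kV_surjective_of_isEmpty_right⟩⟩
    · rcases isEmpty_or_nonempty R with _ | ⟨⟨r₀⟩⟩
      · exact ⟨⟨DPK P Q R S, PUnit, κ P Q R S, _,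
          LeviKAKInput.junctionCompact hV UForm.kV_surjective_of_isEmpty_left⟩⟩
      · exact ⟨⟨DPK P Q R S, ℝ, κ P Q R S, _, LeviKAKInput.junctionSwap r₀ s₀ hV⟩⟩
  · exact ⟨⟨DPK P Q R S, PUnit, κ P Q R S, _,
      LeviKAKInput.junctionCompact hV UForm.kV_surjective_of_isEmpty_left⟩⟩

end RealPairKinds

/-! ### Canonical sign frames and adapted scalings of a nonsingular real diagonal -/

section SignFrame

variable {N : ℕ}

/-- indices where `x` is positive. [folklore] -/
abbrev PosIdx (x : Fin N → ℝ) : Type := {i : Fin N // 0 < x i}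

/-- indices where `x` is not positive (negative, for nonsingular `x`). [folklore] -/
abbrev NegIdx (x : Fin N → ℝ) : Type := {i : Fin N // ¬0 < x i}

/-- the canonical sign frame `Fin N ≃ PosIdx x ⊕ NegIdx x`. [folklore] -/
def signSplit (x : Fin N → ℝ) : Fin N ≃ PosIdx x ⊕ NegIdx x := (Equiv.sumCompl fun i => 0 < x i).symm

/-- `signOf (signSplit x i) · |x i| = x i` for `x i ≠ 0`. [folklore] -/
theorem signOf_signSplit_mul_abs (x : Fin N → ℝ) (i : Fin N) (hx : x i ≠ 0) :
    signOf (signSplit x i) * |x i| = x i := by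
  by_cases h : 0 < x i
  · rw [signSplit, Equiv.sumCompl_symm_apply_of_pos (p := fun j => 0 < x j) (a := i) h, signOf_inl, one_mul, abs_of_pos h]
  · rw [signSplit, Equiv.sumCompl_symm_apply_of_neg (p := fun j => 0 < x j) (a := i) h, signOf_inr, neg_one_mul,
      abs_of_neg (lt_of_le_of_ne (not_lt.1 h) hx), neg_neg]

/-- the adapted scaling `√|x i|`. [folklore] -/
abbrev sqrtAbs (x : Fin N → ℝ) : Fin N → ℝ := fun i => Real.sqrt |x i|

/-- `(√|x i|)² = |x i|`. [folklore] -/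
theorem sqrtAbs_sq (x : Fin N → ℝ) (i : Fin N) : sqrtAbs x i ^ 2 = |x i| := Real.sq_sqrt (abs_nonneg _)

/-- `√|x i| ≠ 0` for `x i ≠ 0`. [folklore] -/
theorem sqrtAbs_ne_zero {x : Fin N → ℝ} {i : Fin N} (hx : x i ≠ 0) : sqrtAbs x i ≠ 0 :=
  (Real.sqrt_pos.2 (abs_pos.2 hx)).ne'

/-- `x = c · signOf (signSplit (x / c)) · (√|x / c|)²`: the identity feeding `htV` / `htW` of the pin theorems for
the canonical frame of `x / c`. [folklore] -/
theorem eq_mul_signOf_signSplit_mul_sqrtAbs_sq {c : ℝ} (hc : c ≠ 0) (x : Fin N → ℝ) (i : Fin N) (hx : x i ≠ 0) :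
    x i = c * signOf (signSplit (fun j => x j / c) i) * sqrtAbs (fun j => x j / c) i ^ 2 := by
  rw [sqrtAbs_sq, mul_assoc, signOf_signSplit_mul_abs (fun j => x j / c) i (div_ne_zero hx hc),
    ← mul_div_assoc, mul_div_cancel_left₀ _ hc]

/-- everywhere positive ⇒ no non-positive index (the form is positive definite). [folklore] -/
theorem isEmpty_negIdx {x : Fin N → ℝ} (h : ∀ i, 0 < x i) : IsEmpty (NegIdx x) := ⟨fun i => i.2 (h i.1)⟩

/-- everywhere negative ⇒ no positive index (the form is negative definite). [folklore] -/
theorem isEmpty_posIdx {x : Fin N → ℝ} (h : ∀ i, x i < 0) : IsEmpty (PosIdx x) :=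
  ⟨fun i => lt_asymm i.2 (h i.1)⟩

/-- at most one non-positive entry ⇒ `|NegIdx x| ≤ 1` (real rank `≤ 1`). [folklore] -/
theorem card_negIdx_le_one {x : Fin N → ℝ} (i₀ : Fin N) (h : ∀ i, i ≠ i₀ → 0 < x i) :
    Fintype.card (NegIdx x) ≤ 1 := by
  refine Fintype.card_le_one_iff_subsingleton.mpr ⟨fun a b => Subtype.ext ?_⟩
  have ha : a.1 = i₀ := by_contra fun hne => a.2 (h a.1 hne)
  have hb : b.1 = i₀ := by_contra fun hne => b.2 (h b.1 hne)
  rw [ha, hb]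

/-- at most one positive entry ⇒ `|PosIdx x| ≤ 1`. [folklore] -/
theorem card_posIdx_le_one {x : Fin N → ℝ} (i₀ : Fin N) (h : ∀ i, i ≠ i₀ → x i < 0) :
    Fintype.card (PosIdx x) ≤ 1 := by
  refine Fintype.card_le_one_iff_subsingleton.mpr ⟨fun a b => Subtype.ext ?_⟩
  have ha : a.1 = i₀ := by_contra fun hne => lt_asymm a.2 (h a.1 hne)
  have hb : b.1 = i₀ := by_contra fun hne => lt_asymm b.2 (h b.1 hne)
  rw [ha, hb]

/-- the entries of a diagonal matrix with unit determinant are nonzero. [folklore] -/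
theorem ne_zero_of_isUnit_det_diagonal {K : Type*} [Field K] {t : Fin N → K} (h : IsUnit (Matrix.diagonal t).det)
    (i : Fin N) : t i ≠ 0 := by
  rw [Matrix.det_diagonal] at h
  exact (Finset.prod_ne_zero_iff.1 h.ne_zero) i (Finset.mem_univ i)

/-- the real vector `σ_v(t) / c_v` whose signs split `Fin N` at the real place `v` (`PosIdx` / `NegIdx`) and whose
absolute values give the adapted scaling (`sqrtAbs`). [folklore] -/
def placeSignVec {F : Type} [Field F] (t : Fin N → F) (cV : {v : InfinitePlace F // v.IsReal} → ℝ)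
    (v : {v : InfinitePlace F // v.IsReal}) : Fin N → ℝ :=
  fun i => embedding_of_isReal v.2 (t i) / cV v

end SignFrame

section SignFrameKinds

variable {N M : ℕ}

/-- **Rank profile (J1) in canonical sign frames**: `x` with at most one non-positive entry (first factor of real
rank `≤ 1`) and `y` of constant sign (second factor definite). [cite: KonnoKonno2007, §3.1 (3.1); Folland1989,
§4.2 (4.24) p. 156, Prop. (4.39); Knapp2002, Thm 7.39] -/
theorem nonempty_anyLeviKAKInput_of_signs_left {x : Fin N → ℝ} {y : Fin M → ℝ} (i₀ : Fin N)
    (hx : ∀ i, i ≠ i₀ → 0 < x i) (hy : (∀ j, 0 < y j) ∨ ∀ j, y j < 0) :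
    Nonempty (AnyLeviKAKInput (γ𝕎[PosIdx x, NegIdx x, PosIdx y, NegIdx y])) :=
  nonempty_anyLeviKAKInput_of_card_le_one (card_negIdx_le_one i₀ hx)
    (hy.elim (fun h => Or.inr (isEmpty_negIdx h)) fun h => Or.inl (isEmpty_posIdx h))

/-- **Rank profile (J2) in canonical sign frames**: `x` of constant sign (first factor definite) and `y` with at
most one non-positive entry or everywhere negative (second factor of real rank `≤ 1` or negative definite).
[cite: MoeglinVignerasWaldspurger1987, Ch. 1 I.17; KonnoKonno2007, §3.1 (3.1); Folland1989, §4.2 (4.24) p. 156,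
Prop. (4.39); Knapp2002, Thm 7.39] -/
theorem nonempty_anyLeviKAKInput_of_signs_right {x : Fin N → ℝ} {y : Fin M → ℝ}
    (hx : (∀ i, 0 < x i) ∨ ∀ i, x i < 0) (hy : (∃ j₀, ∀ j, j ≠ j₀ → 0 < y j) ∨ ∀ j, y j < 0) :
    Nonempty (AnyLeviKAKInput (γ𝕎[PosIdx x, NegIdx x, PosIdx y, NegIdx y])) :=
  nonempty_anyLeviKAKInput_of_compact_left
    (hx.elim (fun h => Or.inr (isEmpty_negIdx h)) fun h => Or.inl (isEmpty_posIdx h))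
    (hy.elim (fun ⟨j₀, h⟩ => Or.inl (card_negIdx_le_one j₀ h)) fun h => Or.inr (isEmpty_posIdx h))

end SignFrameKinds

/-! ## §1 The dictionary and the majorants for a diagonal unitary dual pair over `E/F` -/

section Pair

variable {F : Type} [Field F] [NumberField F] (E : Type) [Field E] [NumberField E] [Algebra F E] (c : E ≃ₐ[F] E)
  (N M : ℕ) {m : ℕ} (e : Fin N × Fin M ≃ Fin m) (hc : c ≠ 1)
  (wOf : {v : InfinitePlace F // v.IsReal} → {w : InfinitePlace E // w.IsComplex})
  (hw : ∀ v, c • (wOf v).1 = (wOf v).1) (hover : ∀ v, (wOf v).1.comap (algebraMap F E) = v.1)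
  (tV : Fin N → F) (tW : Fin M → F) {JV : Matrix (Fin N) (Fin N) E} {JW : Matrix (Fin M) (Fin M) E}
  (hJV : JV = (Matrix.diagonal tV).map (algebraMap F E)) (hJW : JW = (Matrix.diagonal tW).map (algebraMap F E))
  {P Q R S : {v : InfinitePlace F // v.IsReal} → Type*} [∀ v, Fintype (P v)] [∀ v, DecidableEq (P v)]
  [∀ v, Fintype (Q v)] [∀ v, DecidableEq (Q v)] [∀ v, Fintype (R v)] [∀ v, DecidableEq (R v)]
  [∀ v, Fintype (S v)] [∀ v, DecidableEq (S v)]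
  (εV : ∀ v, Fin N ≃ P v ⊕ Q v) (εW : ∀ v, Fin M ≃ R v ⊕ S v)
  {DV : {v : InfinitePlace F // v.IsReal} → Fin N → ℝ} {DW : {v : InfinitePlace F // v.IsReal} → Fin M → ℝ}
  (hDV0 : ∀ v i, DV v i ≠ 0) (hDW0 : ∀ v j, DW v j ≠ 0) {cV cW : {v : InfinitePlace F // v.IsReal} → ℝ}
  (hcV : ∀ v, cV v ≠ 0) (hcW : ∀ v, cW v ≠ 0)
  (htV : ∀ v i, embedding_of_isReal v.2 (tV i) = cV v * signOf (εV v i) * DV v i ^ 2)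
  (htW : ∀ v j, embedding_of_isReal v.2 (tW j) = cW v * signOf (εW v j) * DW v j ^ 2)
  [IsTotallyReal F] [Algebra.IsQuadraticExtension F E] {δ : E} (hcδ : c δ = -δ) (hδ : δ ≠ 0) {d : F}
  (hd : δ * δ = algebraMap F E d) (hV : (Matrix.diagonal tV).IsSymm) (hW : (Matrix.diagonal tW).IsSymm)

/-- **The dictionary.**  In the scaled Folland frame `e_D` of `𝕎_∞`, `D = D_V ⊗ D_W` adapted place by place
(`σ_v t_V = c_V ε_V D_V²`, `σ_v t_W = c_W ε_W D_W²`, `c_V c_W = im σ_{w(v)}(δ)`), the archimedean phase-space action of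
`ι(u₁ ⊗ 1 · 1 ⊗ u₂) ∈ Sp(𝕎_𝔸)` (`u₁ ∈ U(J_V)(𝔸_F)`, `u₂ ∈ U(J_W)(𝔸_F)`) is the slice-by-slice phase map of
Konno–Konno's real dual pairs: `archPhaseMap 𝕋 e_D (ι(u₁ ⊗ 1 · 1 ⊗ u₂)) =
placePhase (v ↦ reindexPhase (pairFrame e ε_V ε_W) (ι𝕎 (archPairPlace v (u₁, u₂))))`.
[cite: GelbartRogawski1991, §3.1 p. 454; KonnoKonno2007, §3.1 (3.1); MoeglinVignerasWaldspurger1987, Ch. 1 I.17;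
Folland1989, Ch. 4 §1, Prop. (4.6) p. 151] -/
theorem archPhaseMap_toSp_pair (hcc : ∀ v, cV v * cW v = ((wOf v).1.embedding δ).im)
    (hTu : IsUnit (archMat F (Fin m)
      (GelbartRogawski1991.UnitaryDualPair.adelicGram F e (Matrix.diagonal tV) (Matrix.diagonal tW))))
    (u₁ : UnitaryGroup.adelic F E c N JV) (u₂ : UnitaryGroup.adelic F E c M JW) :
    archPhaseMap (GelbartRogawski1991.UnitaryDualPair.adelicGram F e (Matrix.diagonal tV) (Matrix.diagonal tW))
        (scaledFrame F (Fin m) (pairScale N M (e := e) DV DW) (pairScale_ne_zero N M hDV0 hDW0)) hTu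
        (GelbartRogawski1991.UnitaryDualPair.toSp F E c N M e JV JW hcδ hδ hd hV hW hJV hJW
          (adelicInl F E c N M JV JW u₁ * adelicInr F E c N M JV JW u₂)) =
      placePhase fun v => reindexPhase (pairFrame (P v) (Q v) (R v) (S v) e (εV v) (εW v))
        (⇑(ι𝕎 (P v) (Q v) (R v) (S v)
          (archPairPlace E c N M hc wOf hw hover tV tW hJV hJW εV εW hDV0 hDW0 hcV hcW htV htW v (u₁, u₂))).1) := by
  funext pq
  obtain ⟨⟨a, b⟩, rfl⟩ := (archFolland_bijective
    (T := GelbartRogawski1991.UnitaryDualPair.adelicGram F e (Matrix.diagonal tV) (Matrix.diagonal tW))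
    (scaledFrame F (Fin m) (pairScale N M (e := e) DV DW) (pairScale_ne_zero N M hDV0 hDW0)) hTu).2 pq
  rw [archPhaseMap_archFolland]
  have key := fun v => archFolland_archAct_toSp_pair_slice E c N M e hc wOf hw hover tV tW hJV hJW εV εW hDV0
    hDW0 hcV hcW htV htW hcδ hδ hd hV hW hcc v u₁ u₂ a b
  refine Prod.ext (funext fun k => ?_) (funext fun k => ?_)
  · obtain ⟨i, v⟩ := k
    rw [placePhase_fst]
    exact congrArg (fun pq : PV (Fin m) => pq.1 i) (key v)
  · obtain ⟨i, v⟩ := k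
    rw [placePhase_snd]
    exact congrArg (fun pq : PV (Fin m) => pq.2 i) (key v)

/-- **Weil's theta majorants for the unitary dual pair.**  For `J_V = diag(t_V) ⊗ 1`, `J_W = diag(t_W) ⊗ 1`
(`t_V`, `t_W` nonsingular), per-place sign frames `ε_V, ε_W` and adapted scalings, a family of Levi-form `KAK`
inputs `I v` for Konno–Konno's real pairs `γ𝕎ᵥ : U(P_v,Q_v) × U(R_v,S_v) → PhaseMap`, and a continuous
COMPATIBLE splitting `s : U(J_V ⊗ J_W)(𝔸) → Mp_ψ(𝕎_𝔸)ᶜᵒⁿᵗ` ([GelbartRogawski1991] (3.1.1)–(3.1.2)): the family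
`(u₁, u₂) ↦ ω_ψ(s_pair(u₁, u₂))` on `𝒮(𝔸_Fⁿ)` `HasThetaMajorants` — by `hasThetaMajorants_omega_comp_of_kakData`
with `γ = placePhase ∘ (reindexPhase (pairFrame …) ∘ γ𝕎ᵥ)ᵥ`, `ϖ = (archPairPlace v)ᵥ` and the dictionary
`archPhaseMap_toSp_pair`. [cite: Weil1964, Chap. III n° 41 Lemme 5 p. 194, Théorème 6 (1) p. 193;
GelbartRogawski1991, §3.1 Prop. 3.1.1 p. 455; Folland1989, §4.2 (4.24) p. 156, Prop. (4.39)] -/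
theorem hasThetaMajorants_omega_pairSplitting (hc : c ≠ 1)
    (wOf : {v : InfinitePlace F // v.IsReal} → {w : InfinitePlace E // w.IsComplex})
    (hw : ∀ v, c • (wOf v).1 = (wOf v).1) (hover : ∀ v, (wOf v).1.comap (algebraMap F E) = v.1)
    (εV : ∀ v, Fin N ≃ P v ⊕ Q v) (εW : ∀ v, Fin M ≃ R v ⊕ S v)
    {DV : {v : InfinitePlace F // v.IsReal} → Fin N → ℝ} {DW : {v : InfinitePlace F // v.IsReal} → Fin M → ℝ}
    (hDV0 : ∀ v i, DV v i ≠ 0) (hDW0 : ∀ v j, DW v j ≠ 0) {cV cW : {v : InfinitePlace F // v.IsReal} → ℝ}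
    (hcV : ∀ v, cV v ≠ 0) (hcW : ∀ v, cW v ≠ 0)
    (htV : ∀ v i, embedding_of_isReal v.2 (tV i) = cV v * signOf (εV v i) * DV v i ^ 2)
    (htW : ∀ v j, embedding_of_isReal v.2 (tW j) = cW v * signOf (εW v j) * DW v j ^ 2) (hcc : ∀ v, cV v * cW v = ((wOf v).1.embedding δ).im)
    (hVd : IsUnit (Matrix.diagonal tV).det) (hWd : IsUnit (Matrix.diagonal tW).det)
    {Kk Pa : {v : InfinitePlace F // v.IsReal} → Type*} [∀ v, TopologicalSpace (Kk v)]
    [∀ v, TopologicalSpace (Pa v)] {κf : ∀ v, Kk v → Ginf (P v) (Q v) (R v) (S v)}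
    {af : ∀ v, Pa v → Ginf (P v) (Q v) (R v) (S v)}
    (I : ∀ v, LeviKAKInput
      (fun g : Ginf (P v) (Q v) (R v) (S v) =>
        (⇑((ι𝕎 (P v) (Q v) (R v) (S v) g).1 :
          (PV (DPIdx (P v) (Q v) (R v) (S v))) ≃ₗ[ℝ] PV (DPIdx (P v) (Q v) (R v) (S v))) :
          PhaseMap (DPIdx (P v) (Q v) (R v) (S v))))
      (κf v) (af v))
    {s : UnitaryGroup.adelicPair F E c N M JV JW →* adelicMpCont F (Fin m)
      (GelbartRogawski1991.UnitaryDualPair.adelicGram F e (Matrix.diagonal tV) (Matrix.diagonal tW))}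
    (hs : (GelbartRogawski1991.UnitaryDualPair.splittingDatum F E c N M e JV JW hcδ hδ hd hV hW hVd hWd hJV
      hJW).IsCompatible s)
    (hsc : Continuous s) :
    HasThetaMajorants (F := F) fun p Φ => adelicMpCont.omega F (Fin m)
      (GelbartRogawski1991.UnitaryDualPair.adelicGram F e (Matrix.diagonal tV) (Matrix.diagonal tW))
      (GelbartRogawski1991.UnitaryDualPair.pairSplitting F E c N M e JV JW s p) Φ :=
  hasThetaMajorants_omega_comp_of_kakData (GelbartRogawski1991.UnitaryDualPair.isUnit_adelicGram F e hVd hWd)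
    (GelbartRogawski1991.UnitaryDualPair.pairSplitting F E c N M e JV JW s)
    (GelbartRogawski1991.UnitaryDualPair.continuous_pairSplitting F E c N M e JV JW hsc)
    (scaledFrame F (Fin m) (pairScale N M (e := e) DV DW) (pairScale_ne_zero N M hDV0 hDW0))
    (isUnit_archMat_of_isUnit _ (GelbartRogawski1991.UnitaryDualPair.isUnit_adelicGram F e hVd hWd))
    (kakImplementerData_leviFamily_places_reindex (fun v => pairFrame (P v) (Q v) (R v) (S v) e (εV v) (εW v)) I)
    (fun p v => archPairPlace E c N M hc wOf hw hover tV tW hJV hJW εV εW hDV0 hDW0 hcV hcW htV htW v p)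
    (continuous_archPairPlace_pi E c N M hc wOf hw hover tV tW hJV hJW εV εW hDV0 hDW0 hcV hcW htV htW)
    fun p => by
      rw [GelbartRogawski1991.UnitaryDualPair.proj_pairSplitting F E c N M e JV JW hcδ hδ hd hV hW hVd hWd hJV
        hJW hs p]
      exact archPhaseMap_toSp_pair E c N M e hc wOf hw hover tV tW hJV hJW εV εW hDV0 hDW0 hcV hcW htV htW hcδ
        hδ hd hV hW hcc _ p.1 p.2

/-- `hasThetaMajorants_omega_pairSplitting` from ONE kind-erased Levi-form `KAK` input per place (`AnyLeviKAKInput`,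
chosen by `Classical.choice`; the conclusion is a `Prop`). [cite: Weil1964, Chap. III n° 41 Lemme 5 p. 194,
Théorème 6 (1) p. 193; GelbartRogawski1991, §3.1 Prop. 3.1.1 p. 455; Folland1989, §4.2 (4.24) p. 156, Prop. (4.39)] -/
theorem hasThetaMajorants_omega_pairSplitting_of_nonempty (hc : c ≠ 1)
    (wOf : {v : InfinitePlace F // v.IsReal} → {w : InfinitePlace E // w.IsComplex})
    (hw : ∀ v, c • (wOf v).1 = (wOf v).1) (hover : ∀ v, (wOf v).1.comap (algebraMap F E) = v.1)
    (εV : ∀ v, Fin N ≃ P v ⊕ Q v) (εW : ∀ v, Fin M ≃ R v ⊕ S v)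
    {DV : {v : InfinitePlace F // v.IsReal} → Fin N → ℝ} {DW : {v : InfinitePlace F // v.IsReal} → Fin M → ℝ}
    (hDV0 : ∀ v i, DV v i ≠ 0) (hDW0 : ∀ v j, DW v j ≠ 0) {cV cW : {v : InfinitePlace F // v.IsReal} → ℝ}
    (hcV : ∀ v, cV v ≠ 0) (hcW : ∀ v, cW v ≠ 0)
    (htV : ∀ v i, embedding_of_isReal v.2 (tV i) = cV v * signOf (εV v i) * DV v i ^ 2)
    (htW : ∀ v j, embedding_of_isReal v.2 (tW j) = cW v * signOf (εW v j) * DW v j ^ 2)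
    (hcc : ∀ v, cV v * cW v = ((wOf v).1.embedding δ).im)
    (hVd : IsUnit (Matrix.diagonal tV).det) (hWd : IsUnit (Matrix.diagonal tW).det)
    (hI : ∀ v, Nonempty (AnyLeviKAKInput (γ𝕎[P v, Q v, R v, S v])))
    {s : UnitaryGroup.adelicPair F E c N M JV JW →* adelicMpCont F (Fin m)
      (GelbartRogawski1991.UnitaryDualPair.adelicGram F e (Matrix.diagonal tV) (Matrix.diagonal tW))}
    (hs : (GelbartRogawski1991.UnitaryDualPair.splittingDatum F E c N M e JV JW hcδ hδ hd hV hW hVd hWd hJV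
      hJW).IsCompatible s)
    (hsc : Continuous s) :
    HasThetaMajorants (F := F) fun p Φ => adelicMpCont.omega F (Fin m)
      (GelbartRogawski1991.UnitaryDualPair.adelicGram F e (Matrix.diagonal tV) (Matrix.diagonal tW))
      (GelbartRogawski1991.UnitaryDualPair.pairSplitting F E c N M e JV JW s p) Φ :=
  hasThetaMajorants_omega_pairSplitting E c N M e tV tW hJV hJW hcδ hδ hd hV hW hc wOf hw hover εV εW hDV0 hDW0
    hcV hcW htV htW hcc hVd hWd (fun v => (Classical.choice (hI v)).input) hs hsc

/-- **Weil's theta majorants for the unitary dual pair, CANONICAL FRAMES.**  Same as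
`hasThetaMajorants_omega_pairSplitting` with the sign frames and scalings CHOSEN: at each real place `v` the first
factor is split by the signs of `σ_v(t_V) / c_V(v)` and the second by the signs of `σ_v(t_W) · c_V(v) / im σ_{w(v)}(δ)`
(`c_V` any nowhere-zero real function — the consumer's freedom to decide which block is "positive"), scalings
`√|·|`.  The only archimedean input left is ONE kind-erased Levi-form `KAK` input per place for the resulting real
pair `U(PosIdx, NegIdx) × U(PosIdx, NegIdx)` (`nonempty_anyLeviKAKInput_of_card_le_one` / `_of_compact_left`).
[cite: Weil1964, Chap. III n° 41 Lemme 5 p. 194, Théorème 6 (1) p. 193; GelbartRogawski1991, §3.1 Prop. 3.1.1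
p. 455; KonnoKonno2007, §3.1 (3.1); Folland1989, §4.2 (4.24) p. 156, Prop. (4.39)] -/
theorem hasThetaMajorants_omega_pairSplitting_canonical (hc : c ≠ 1)
    (wOf : {v : InfinitePlace F // v.IsReal} → {w : InfinitePlace E // w.IsComplex})
    (hw : ∀ v, c • (wOf v).1 = (wOf v).1) (hover : ∀ v, (wOf v).1.comap (algebraMap F E) = v.1)
    (cV : {v : InfinitePlace F // v.IsReal} → ℝ) (hcV : ∀ v, cV v ≠ 0)
    (hVd : IsUnit (Matrix.diagonal tV).det) (hWd : IsUnit (Matrix.diagonal tW).det)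
    (hI : ∀ v, Nonempty (AnyLeviKAKInput
      (γ𝕎[PosIdx (placeSignVec tV cV v), NegIdx (placeSignVec tV cV v),
        PosIdx (placeSignVec tW (fun v => ((wOf v).1.embedding δ).im / cV v) v),
        NegIdx (placeSignVec tW (fun v => ((wOf v).1.embedding δ).im / cV v) v)])))
    {s : UnitaryGroup.adelicPair F E c N M JV JW →* adelicMpCont F (Fin m)
      (GelbartRogawski1991.UnitaryDualPair.adelicGram F e (Matrix.diagonal tV) (Matrix.diagonal tW))}
    (hs : (GelbartRogawski1991.UnitaryDualPair.splittingDatum F E c N M e JV JW hcδ hδ hd hV hW hVd hWd hJV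
      hJW).IsCompatible s)
    (hsc : Continuous s) :
    HasThetaMajorants (F := F) fun p Φ => adelicMpCont.omega F (Fin m)
      (GelbartRogawski1991.UnitaryDualPair.adelicGram F e (Matrix.diagonal tV) (Matrix.diagonal tW))
      (GelbartRogawski1991.UnitaryDualPair.pairSplitting F E c N M e JV JW s p) Φ :=
  have hδv : ∀ v : {v : InfinitePlace F // v.IsReal}, ((wOf v).1.embedding δ).im ≠ 0 := fun v =>
    UnitaryGroup.im_embedding_delta_ne_zero F E c (wOf v) (hw v) hc hcδ hδ
  have htV0 : ∀ (v : {v : InfinitePlace F // v.IsReal}) i, embedding_of_isReal v.2 (tV i) ≠ 0 := fun v i =>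
    (map_ne_zero _).2 (ne_zero_of_isUnit_det_diagonal hVd i)
  have htW0 : ∀ (v : {v : InfinitePlace F // v.IsReal}) j, embedding_of_isReal v.2 (tW j) ≠ 0 := fun v j =>
    (map_ne_zero _).2 (ne_zero_of_isUnit_det_diagonal hWd j)
  hasThetaMajorants_omega_pairSplitting_of_nonempty E c N M e tV tW hJV hJW hcδ hδ hd hV hW hc wOf hw hover
    (fun v => signSplit (placeSignVec tV cV v))
    (fun v => signSplit (placeSignVec tW (fun v => ((wOf v).1.embedding δ).im / cV v) v))
    (DV := fun v => sqrtAbs (placeSignVec tV cV v))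
    (DW := fun v => sqrtAbs (placeSignVec tW (fun v => ((wOf v).1.embedding δ).im / cV v) v))
    (fun v i => sqrtAbs_ne_zero (div_ne_zero (htV0 v i) (hcV v)))
    (fun v j => sqrtAbs_ne_zero (div_ne_zero (htW0 v j) (div_ne_zero (hδv v) (hcV v))))
    (cV := cV) (cW := fun v => ((wOf v).1.embedding δ).im / cV v) hcV
    (fun v => div_ne_zero (hδv v) (hcV v))
    (fun v i => eq_mul_signOf_signSplit_mul_sqrtAbs_sq (hcV v) (fun j => embedding_of_isReal v.2 (tV j)) i
      (htV0 v i))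
    (fun v j => eq_mul_signOf_signSplit_mul_sqrtAbs_sq (div_ne_zero (hδv v) (hcV v))
      (fun j => embedding_of_isReal v.2 (tW j)) j (htW0 v j))
    (fun v => by rw [← mul_div_assoc, mul_div_cancel_left₀ _ (hcV v)]) hVd hWd hI hs hsc

end Pair

/-! ## §2 The CM pin: the hypothesis `hρ` of `GelbartRogawski1991.UnitaryDualPair.cmThetaKernelDatum` -/

section CM

variable (L : Type) [Field L] [NumberField L] [IsCMField L]

/-- **A complex place of the CM field `L` over the real place `v` of `L⁺`** (chosen; all places of `L` are
complex, `comap` is onto). [folklore] -/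
def cmPlaceOver (v : {v : InfinitePlace ↥(maximalRealSubfield L) // v.IsReal}) :
    {w : InfinitePlace L // w.IsComplex} :=
  ⟨(comap_surjective (K := L) (k := ↥(maximalRealSubfield L)) v.1).choose, IsTotallyComplex.isComplex _⟩

/-- complex conjugation fixes the chosen place. [folklore] -/
theorem cmPlaceOver_smul (v : {v : InfinitePlace ↥(maximalRealSubfield L) // v.IsReal}) :
    IsCMField.complexConj L • (cmPlaceOver L v).1 = (cmPlaceOver L v).1 :=
  complexConj_smul_infinitePlace L _

/-- the chosen place lies over `v`. [folklore] -/
theorem cmPlaceOver_comap (v : {v : InfinitePlace ↥(maximalRealSubfield L) // v.IsReal}) :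
    (cmPlaceOver L v).1.comap (algebraMap (↥(maximalRealSubfield L)) L) = v.1 :=
  (comap_surjective (K := L) (k := ↥(maximalRealSubfield L)) v.1).choose_spec

variable {N : ℕ} in
/-- the conjugation-fixed entries `dᵢ ∈ L` as elements of `L⁺` (`realDiagonal L d hd = diag (cmRealVec L d hd)`,
definitionally). [folklore] -/
def cmRealVec (d : Fin N → L) (hd : ∀ i, IsCMField.complexConj L (d i) = d i) : Fin N → ↥(maximalRealSubfield L) :=
  fun i => ⟨d i, (IsCMField.complexConj_eq_self_iff (K := L) (d i)).1 (hd i)⟩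

variable {N : ℕ} in
/-- `realDiagonal L d hd = diag (cmRealVec L d hd)`. [folklore] -/
theorem realDiagonal_eq_diagonal (d : Fin N → L) (hd : ∀ i, IsCMField.complexConj L (d i) = d i) :
    GelbartRogawski1991.UnitaryDualPair.realDiagonal L d hd = Matrix.diagonal (cmRealVec L d hd) := rfl

omit [NumberField L] [IsCMField L] in
/-- **Over a real place `v` of `L⁺`, every complex embedding `τ` of `L` lying over `v` restricts on `L⁺` to THE
real embedding of `v`** (`v` real: its embedding is conjugation-invariant). [folklore] -/
theorem embedding_algebraMap_eq_embedding_of_isReal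
    (v : {v : InfinitePlace ↥(maximalRealSubfield L) // v.IsReal}) (τ : L →+* ℂ)
    (hτ : (InfinitePlace.mk τ).comap (algebraMap (↥(maximalRealSubfield L)) L) = v.1)
    (x : ↥(maximalRealSubfield L)) :
    τ (algebraMap (↥(maximalRealSubfield L)) L x) = (embedding_of_isReal v.2 x : ℂ) := by
  rw [embedding_of_isReal_apply]
  have h1 : InfinitePlace.mk (τ.comp (algebraMap (↥(maximalRealSubfield L)) L)) =
      InfinitePlace.mk (InfinitePlace.embedding v.1) := by
    rw [← comap_mk, hτ, mk_embedding]
  have hr : ComplexEmbedding.conjugate (InfinitePlace.embedding v.1) = InfinitePlace.embedding v.1 :=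
    ComplexEmbedding.isReal_iff.1 (InfinitePlace.isReal_iff.1 v.2)
  rcases mk_eq_iff.1 h1 with h | h
  · exact RingHom.congr_fun h x
  · have h' := RingHom.congr_fun h x
    rw [ComplexEmbedding.conjugate_coe_eq, RingHom.comp_apply] at h'
    rw [← hr, ComplexEmbedding.conjugate_coe_eq, ← h', Complex.conj_conj]

/-- **The complex place of `L` over a real place of `L⁺` is unique** (`IsCMField.equivInfinitePlace`): any complex
embedding `τ` over `v` defines the chosen place `cmPlaceOver L v`. [folklore] -/
theorem cmPlaceOver_eq_mk (v : {v : InfinitePlace ↥(maximalRealSubfield L) // v.IsReal}) (τ : L →+* ℂ)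
    (hτ : (InfinitePlace.mk τ).comap (algebraMap (↥(maximalRealSubfield L)) L) = v.1) :
    (cmPlaceOver L v).1 = InfinitePlace.mk τ :=
  (IsCMField.equivInfinitePlace L).injective
    (by rw [IsCMField.equivInfinitePlace_apply, IsCMField.equivInfinitePlace_apply, cmPlaceOver_comap, hτ])

/-- hence the embedding of `cmPlaceOver L v` is `τ` or its conjugate: imaginary parts agree UP TO SIGN.
[folklore] -/
theorem im_embedding_cmPlaceOver_eq_or (v : {v : InfinitePlace ↥(maximalRealSubfield L) // v.IsReal})
    (τ : L →+* ℂ) (hτ : (InfinitePlace.mk τ).comap (algebraMap (↥(maximalRealSubfield L)) L) = v.1) (x : L) :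
    ((cmPlaceOver L v).1.embedding x).im = (τ x).im ∨ ((cmPlaceOver L v).1.embedding x).im = -(τ x).im := by
  have h1 : InfinitePlace.mk (cmPlaceOver L v).1.embedding = InfinitePlace.mk τ := by
    rw [mk_embedding]; exact cmPlaceOver_eq_mk L v τ hτ
  rcases mk_eq_iff.1 h1 with h | h
  · exact Or.inl (by rw [h])
  · refine Or.inr ?_
    have h' : τ x = conj ((cmPlaceOver L v).1.embedding x) := by rw [← h, ComplexEmbedding.conjugate_coe_eq]
    rw [h', Complex.conj_im, neg_neg]

/-- `im σ_{w(v)}(δ_L) ≠ 0` for the CM imaginary unit `δ_L = imagUnit L` at the chosen place over `v`.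
[cite: GelbartRogawski1991, §3.1 p. 454] -/
theorem im_embedding_cmPlaceOver_imagUnit_ne_zero (v : {v : InfinitePlace ↥(maximalRealSubfield L) // v.IsReal}) :
    ((cmPlaceOver L v).1.embedding (GelbartRogawski1991.UnitaryDualPair.imagUnit L)).im ≠ 0 :=
  UnitaryGroup.im_embedding_delta_ne_zero (↥(maximalRealSubfield L)) L (IsCMField.complexConj L) (cmPlaceOver L v)
    (cmPlaceOver_smul L v) (IsCMField.complexConj_ne_one L)
    (GelbartRogawski1991.UnitaryDualPair.complexConj_imagUnit L)
    (GelbartRogawski1991.UnitaryDualPair.imagUnit_ne_zero L)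

variable {N : ℕ} in
/-- the entries of `cmRealVec` through any complex embedding `τ` over `v`: `σ_v(dᵢ) = τ(dᵢ)`. [folklore] -/
theorem embedding_of_isReal_cmRealVec (v : {v : InfinitePlace ↥(maximalRealSubfield L) // v.IsReal})
    (τ : L →+* ℂ) (hτ : (InfinitePlace.mk τ).comap (algebraMap (↥(maximalRealSubfield L)) L) = v.1)
    (d : Fin N → L) (hd : ∀ i, IsCMField.complexConj L (d i) = d i) (i : Fin N) :
    (embedding_of_isReal v.2 (cmRealVec L d hd i) : ℂ) = τ (d i) := by
  rw [← embedding_algebraMap_eq_embedding_of_isReal L v τ hτ]; rfl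

variable {N : ℕ} in
/-- **the canonical sign vector at a real place, read through any complex embedding `τ` over it**:
`placeSignVec (cmRealVec L d hd) c v i = re τ(dᵢ) / c v` (and `τ(dᵢ)` is real). [folklore] -/
theorem placeSignVec_cmRealVec (v : {v : InfinitePlace ↥(maximalRealSubfield L) // v.IsReal})
    (τ : L →+* ℂ) (hτ : (InfinitePlace.mk τ).comap (algebraMap (↥(maximalRealSubfield L)) L) = v.1)
    (d : Fin N → L) (hd : ∀ i, IsCMField.complexConj L (d i) = d i)
    (cv : {v : InfinitePlace ↥(maximalRealSubfield L) // v.IsReal} → ℝ) (i : Fin N) :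
    placeSignVec (cmRealVec L d hd) cv v i = (τ (d i)).re / cv v := by
  show embedding_of_isReal v.2 (cmRealVec L d hd i) / cv v = _
  rw [← embedding_of_isReal_cmRealVec L v τ hτ d hd i, Complex.ofReal_re]

variable {N M n : ℕ} (e : Fin N × Fin M ≃ Fin n)
  (dV : Fin N → L) (hdV : ∀ i, IsCMField.complexConj L (dV i) = dV i) (hdV0 : ∀ i, dV i ≠ 0)
  (dW : Fin M → L) (hdW : ∀ i, IsCMField.complexConj L (dW i) = dW i) (hdW0 : ∀ i, dW i ≠ 0)
  {P Q R S : {v : InfinitePlace ↥(maximalRealSubfield L) // v.IsReal} → Type*} [∀ v, Fintype (P v)]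
  [∀ v, DecidableEq (P v)] [∀ v, Fintype (Q v)] [∀ v, DecidableEq (Q v)] [∀ v, Fintype (R v)]
  [∀ v, DecidableEq (R v)] [∀ v, Fintype (S v)] [∀ v, DecidableEq (S v)]

/-- **The CM pin — the hypothesis `hρ` of `cmThetaKernelDatum`.**  For the CM dual pair `(U(diag d_V), U(diag d_W))`
over `L/L⁺` with its chosen compatible splitting `cmPairSplitting` ([GelbartRogawski1991] Prop. 3.1.1), per-place
sign frames `ε_V v : Fin N ≃ P_v ⊕ Q_v`, `ε_W v` and adapted scalings of the real numbers `σ_v(d_V)`, `σ_v(d_W)`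
(`σ_v d_V = c_V ε_V D_V²`, `σ_v d_W = c_W ε_W D_W²`, `c_V c_W = im σ_{w(v)}(δ)`, `δ = imagUnit L`), and a family of
Levi-form `KAK` inputs for the real pairs `U(P_v,Q_v) × U(R_v,S_v)` (`LeviKAKInput.junction` / `.junctionSwap` /
`.junctionCompact` of `Weil1964.ArchLeviKAKInput`), the family `(u₁, u₂) ↦ ω_ψ(s_pair(u₁, u₂))` `HasThetaMajorants`.
[cite: Weil1964, Chap. III n° 41 Lemme 5 p. 194, Théorème 6 (1) p. 193; GelbartRogawski1991, §3.1 Prop. 3.1.1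
p. 455; KonnoKonno2007, §3.1 (3.1); Folland1989, §4.2 (4.24) p. 156, Prop. (4.39)] -/
theorem hasThetaMajorants_cmPairSplitting
    (εV : ∀ v, Fin N ≃ P v ⊕ Q v) (εW : ∀ v, Fin M ≃ R v ⊕ S v)
    {DV : {v : InfinitePlace ↥(maximalRealSubfield L) // v.IsReal} → Fin N → ℝ}
    {DW : {v : InfinitePlace ↥(maximalRealSubfield L) // v.IsReal} → Fin M → ℝ}
    (hDV0 : ∀ v i, DV v i ≠ 0) (hDW0 : ∀ v j, DW v j ≠ 0)
    {cV cW : {v : InfinitePlace ↥(maximalRealSubfield L) // v.IsReal} → ℝ} (hcV : ∀ v, cV v ≠ 0)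
    (hcW : ∀ v, cW v ≠ 0)
    (htV : ∀ v i, embedding_of_isReal v.2 (cmRealVec L dV hdV i) = cV v * signOf (εV v i) * DV v i ^ 2)
    (htW : ∀ v j, embedding_of_isReal v.2 (cmRealVec L dW hdW j) = cW v * signOf (εW v j) * DW v j ^ 2)
    (hcc : ∀ v, cV v * cW v =
      ((cmPlaceOver L v).1.embedding (GelbartRogawski1991.UnitaryDualPair.imagUnit L)).im)
    (hGR : (GelbartRogawski1991.UnitaryDualPair.cmSplittingDatum L e dV hdV hdV0 dW hdW hdW0).CompatibleSplitting)
    {Kk Pa : {v : InfinitePlace ↥(maximalRealSubfield L) // v.IsReal} → Type*} [∀ v, TopologicalSpace (Kk v)]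
    [∀ v, TopologicalSpace (Pa v)] {κf : ∀ v, Kk v → Ginf (P v) (Q v) (R v) (S v)}
    {af : ∀ v, Pa v → Ginf (P v) (Q v) (R v) (S v)}
    (I : ∀ v, LeviKAKInput
      (fun g : Ginf (P v) (Q v) (R v) (S v) =>
        (⇑((ι𝕎 (P v) (Q v) (R v) (S v) g).1 :
          (PV (DPIdx (P v) (Q v) (R v) (S v))) ≃ₗ[ℝ] PV (DPIdx (P v) (Q v) (R v) (S v))) :
          PhaseMap (DPIdx (P v) (Q v) (R v) (S v))))
      (κf v) (af v)) :
    HasThetaMajorants fun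
      (p : ↥(UnitaryGroup.adelic (↥(maximalRealSubfield L)) L (IsCMField.complexConj L) N (Matrix.diagonal dV)) ×
        ↥(UnitaryGroup.adelic (↥(maximalRealSubfield L)) L (IsCMField.complexConj L) M (Matrix.diagonal dW)))
      (Φ : piSchwartzBruhat (↥(maximalRealSubfield L)) (Fin n)) =>
        adelicMpCont.omega (↥(maximalRealSubfield L)) (Fin n)
          (GelbartRogawski1991.UnitaryDualPair.adelicGram (↥(maximalRealSubfield L)) e
            (GelbartRogawski1991.UnitaryDualPair.realDiagonal L dV hdV)
            (GelbartRogawski1991.UnitaryDualPair.realDiagonal L dW hdW))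
          (GelbartRogawski1991.UnitaryDualPair.cmPairSplitting L e dV hdV hdV0 dW hdW hdW0 hGR p) Φ :=
  hasThetaMajorants_omega_pairSplitting L (IsCMField.complexConj L) N M e (cmRealVec L dV hdV) (cmRealVec L dW hdW)
    (GelbartRogawski1991.UnitaryDualPair.realDiagonal_map L dV hdV).symm
    (GelbartRogawski1991.UnitaryDualPair.realDiagonal_map L dW hdW).symm
    (GelbartRogawski1991.UnitaryDualPair.complexConj_imagUnit L)
    (GelbartRogawski1991.UnitaryDualPair.imagUnit_ne_zero L)
    (GelbartRogawski1991.UnitaryDualPair.imagUnit_mul_self L)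
    (GelbartRogawski1991.UnitaryDualPair.realDiagonal_isSymm L dV hdV)
    (GelbartRogawski1991.UnitaryDualPair.realDiagonal_isSymm L dW hdW)
    (IsCMField.complexConj_ne_one L) (cmPlaceOver L) (cmPlaceOver_smul L) (cmPlaceOver_comap L)
    εV εW hDV0 hDW0 hcV hcW htV htW hcc
    (GelbartRogawski1991.UnitaryDualPair.isUnit_det_realDiagonal L dV hdV hdV0)
    (GelbartRogawski1991.UnitaryDualPair.isUnit_det_realDiagonal L dW hdW hdW0) I
    (GelbartRogawski1991.UnitaryDualPair.splittingOf_isCompatible _ _ _ _ _ _ _ _ _ _ _ _ _ _ _ _ _ hGR)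
    (GelbartRogawski1991.UnitaryDualPair.continuous_splittingOf _ _ _ _ _ _ _ _ _ _ _ _ _ _ _ _ _ hGR)

/-- **The CM pin from ONE kind-erased Levi-form `KAK` input per place** (`AnyLeviKAKInput`; frames and scalings still
supplied). [cite: Weil1964, Chap. III n° 41 Lemme 5 p. 194, Théorème 6 (1) p. 193; GelbartRogawski1991, §3.1
Prop. 3.1.1 p. 455; KonnoKonno2007, §3.1 (3.1); Folland1989, §4.2 (4.24) p. 156, Prop. (4.39)] -/
theorem hasThetaMajorants_cmPairSplitting_of_nonempty
    (εV : ∀ v, Fin N ≃ P v ⊕ Q v) (εW : ∀ v, Fin M ≃ R v ⊕ S v)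
    {DV : {v : InfinitePlace ↥(maximalRealSubfield L) // v.IsReal} → Fin N → ℝ}
    {DW : {v : InfinitePlace ↥(maximalRealSubfield L) // v.IsReal} → Fin M → ℝ}
    (hDV0 : ∀ v i, DV v i ≠ 0) (hDW0 : ∀ v j, DW v j ≠ 0)
    {cV cW : {v : InfinitePlace ↥(maximalRealSubfield L) // v.IsReal} → ℝ} (hcV : ∀ v, cV v ≠ 0)
    (hcW : ∀ v, cW v ≠ 0)
    (htV : ∀ v i, embedding_of_isReal v.2 (cmRealVec L dV hdV i) = cV v * signOf (εV v i) * DV v i ^ 2)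
    (htW : ∀ v j, embedding_of_isReal v.2 (cmRealVec L dW hdW j) = cW v * signOf (εW v j) * DW v j ^ 2)
    (hcc : ∀ v, cV v * cW v =
      ((cmPlaceOver L v).1.embedding (GelbartRogawski1991.UnitaryDualPair.imagUnit L)).im)
    (hGR : (GelbartRogawski1991.UnitaryDualPair.cmSplittingDatum L e dV hdV hdV0 dW hdW hdW0).CompatibleSplitting)
    (hI : ∀ v, Nonempty (AnyLeviKAKInput (γ𝕎[P v, Q v, R v, S v]))) :
    HasThetaMajorants fun
      (p : ↥(UnitaryGroup.adelic (↥(maximalRealSubfield L)) L (IsCMField.complexConj L) N (Matrix.diagonal dV)) ×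
        ↥(UnitaryGroup.adelic (↥(maximalRealSubfield L)) L (IsCMField.complexConj L) M (Matrix.diagonal dW)))
      (Φ : piSchwartzBruhat (↥(maximalRealSubfield L)) (Fin n)) =>
        adelicMpCont.omega (↥(maximalRealSubfield L)) (Fin n)
          (GelbartRogawski1991.UnitaryDualPair.adelicGram (↥(maximalRealSubfield L)) e
            (GelbartRogawski1991.UnitaryDualPair.realDiagonal L dV hdV)
            (GelbartRogawski1991.UnitaryDualPair.realDiagonal L dW hdW))
          (GelbartRogawski1991.UnitaryDualPair.cmPairSplitting L e dV hdV hdV0 dW hdW hdW0 hGR p) Φ :=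
  hasThetaMajorants_cmPairSplitting L e dV hdV hdV0 dW hdW hdW0 εV εW hDV0 hDW0 hcV hcW htV htW hcc hGR
    fun v => (Classical.choice (hI v)).input

/-- **The CM pin, CANONICAL FRAMES — the hypothesis `hρ` of `cmThetaKernelDatum` from ONE kind-erased Levi-form
`KAK` input per real place of `L⁺`.**  The consumer chooses a nowhere-zero `c_V : {v // v.IsReal} → ℝ` (deciding, at
each place, which sign block of `σ_v(d_V)` is "positive"); the real pair at `v` is then
`U(PosIdx x_V, NegIdx x_V) × U(PosIdx x_W, NegIdx x_W)` with `x_V = σ_v(d_V)/c_V(v)` (`placeSignVec`),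
`x_W = σ_v(d_W) c_V(v) / im σ_{w(v)}(δ_L)`, `δ_L = imagUnit L`, `w(v) = cmPlaceOver L v`, and it remains to give
`Nonempty (AnyLeviKAKInput γ𝕎ᵥ)` — for `|NegIdx x_V| ≤ 1` with `x_W` of constant sign use
`nonempty_anyLeviKAKInput_of_card_le_one` (`card_negIdx_le_one`, `isEmpty_negIdx` / `isEmpty_posIdx`), for `x_V` of
constant sign and `|NegIdx x_W| ≤ 1` or `x_W < 0` use `nonempty_anyLeviKAKInput_of_compact_left`.
[cite: Weil1964, Chap. III n° 41 Lemme 5 p. 194, Théorème 6 (1) p. 193; GelbartRogawski1991, §3.1 Prop. 3.1.1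
p. 455; KonnoKonno2007, §3.1 (3.1); MoeglinVignerasWaldspurger1987, Ch. 1 I.17; Folland1989, §4.2 (4.24) p. 156,
Prop. (4.39)] -/
theorem hasThetaMajorants_cmPairSplitting_canonical
    (cV : {v : InfinitePlace ↥(maximalRealSubfield L) // v.IsReal} → ℝ) (hcV : ∀ v, cV v ≠ 0)
    (hGR : (GelbartRogawski1991.UnitaryDualPair.cmSplittingDatum L e dV hdV hdV0 dW hdW hdW0).CompatibleSplitting)
    (hI : ∀ v, Nonempty (AnyLeviKAKInput
      (γ𝕎[PosIdx (placeSignVec (cmRealVec L dV hdV) cV v), NegIdx (placeSignVec (cmRealVec L dV hdV) cV v),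
        PosIdx (placeSignVec (cmRealVec L dW hdW) (fun v =>
          ((cmPlaceOver L v).1.embedding (GelbartRogawski1991.UnitaryDualPair.imagUnit L)).im / cV v) v),
        NegIdx (placeSignVec (cmRealVec L dW hdW) (fun v =>
          ((cmPlaceOver L v).1.embedding (GelbartRogawski1991.UnitaryDualPair.imagUnit L)).im / cV v) v)]))) :
    HasThetaMajorants fun
      (p : ↥(UnitaryGroup.adelic (↥(maximalRealSubfield L)) L (IsCMField.complexConj L) N (Matrix.diagonal dV)) ×
        ↥(UnitaryGroup.adelic (↥(maximalRealSubfield L)) L (IsCMField.complexConj L) M (Matrix.diagonal dW)))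
      (Φ : piSchwartzBruhat (↥(maximalRealSubfield L)) (Fin n)) =>
        adelicMpCont.omega (↥(maximalRealSubfield L)) (Fin n)
          (GelbartRogawski1991.UnitaryDualPair.adelicGram (↥(maximalRealSubfield L)) e
            (GelbartRogawski1991.UnitaryDualPair.realDiagonal L dV hdV)
            (GelbartRogawski1991.UnitaryDualPair.realDiagonal L dW hdW))
          (GelbartRogawski1991.UnitaryDualPair.cmPairSplitting L e dV hdV hdV0 dW hdW hdW0 hGR p) Φ :=
  hasThetaMajorants_omega_pairSplitting_canonical L (IsCMField.complexConj L) N M e (cmRealVec L dV hdV)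
    (cmRealVec L dW hdW) (GelbartRogawski1991.UnitaryDualPair.realDiagonal_map L dV hdV).symm
    (GelbartRogawski1991.UnitaryDualPair.realDiagonal_map L dW hdW).symm
    (GelbartRogawski1991.UnitaryDualPair.complexConj_imagUnit L)
    (GelbartRogawski1991.UnitaryDualPair.imagUnit_ne_zero L)
    (GelbartRogawski1991.UnitaryDualPair.imagUnit_mul_self L)
    (GelbartRogawski1991.UnitaryDualPair.realDiagonal_isSymm L dV hdV)
    (GelbartRogawski1991.UnitaryDualPair.realDiagonal_isSymm L dW hdW)
    (IsCMField.complexConj_ne_one L) (cmPlaceOver L) (cmPlaceOver_smul L) (cmPlaceOver_comap L) cV hcV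
    (GelbartRogawski1991.UnitaryDualPair.isUnit_det_realDiagonal L dV hdV hdV0)
    (GelbartRogawski1991.UnitaryDualPair.isUnit_det_realDiagonal L dW hdW hdW0) hI
    (GelbartRogawski1991.UnitaryDualPair.splittingOf_isCompatible _ _ _ _ _ _ _ _ _ _ _ _ _ _ _ _ _ hGR)
    (GelbartRogawski1991.UnitaryDualPair.continuous_splittingOf _ _ _ _ _ _ _ _ _ _ _ _ _ _ _ _ _ hGR)

/-! ### The consumer's form: sign facts through complex embeddings -/

/-- dividing a family of constant strict sign by a non-zero constant keeps it of constant strict sign. [folklore] -/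
theorem forall_pos_or_forall_neg_div {ι : Type*} {a : ι → ℝ} (h : (∀ j, 0 < a j) ∨ ∀ j, a j < 0) {r : ℝ}
    (hr : r ≠ 0) : (∀ j, 0 < a j / r) ∨ ∀ j, a j / r < 0 := by
  rcases lt_or_gt_of_ne hr with hr | hr
  · exact h.elim (fun h => Or.inr fun j => div_neg_of_pos_of_neg (h j) hr) fun h =>
      Or.inl fun j => div_pos_of_neg_of_neg (h j) hr
  · exact h.elim (fun h => Or.inl fun j => div_pos (h j) hr) fun h =>
      Or.inr fun j => div_neg_of_neg_of_pos (h j) hr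

/-- **The sign convention of the consumer's form**: `±1` at the real place under the distinguished embedding `ι₁`
(`+1` iff all but one of the `re ι₁(d_V i)` are positive), `im σ_{w(v)}(δ_L)` at every other real place `v`.
[folklore] -/
def cmSignConv (ι₁ : L →+* ℂ) (v : {v : InfinitePlace ↥(maximalRealSubfield L) // v.IsReal}) : ℝ :=
  if v.1 = (InfinitePlace.mk ι₁).comap (algebraMap (↥(maximalRealSubfield L)) L) then
    (if ∃ i₀ : Fin N, ∀ i, i ≠ i₀ → 0 < (ι₁ (dV i)).re then 1 else -1)
  else ((cmPlaceOver L v).1.embedding (GelbartRogawski1991.UnitaryDualPair.imagUnit L)).im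

/-- the sign convention vanishes nowhere. [cite: GelbartRogawski1991, §3.1 p. 454] -/
theorem cmSignConv_ne_zero (ι₁ : L →+* ℂ) (v : {v : InfinitePlace ↥(maximalRealSubfield L) // v.IsReal}) :
    cmSignConv L dV ι₁ v ≠ 0 := by
  unfold cmSignConv
  split_ifs <;> first | exact im_embedding_cmPlaceOver_imagUnit_ne_zero L v | norm_num

/-- **The per-place Levi-form `KAK` kind from sign facts through complex embeddings**, in the frames of
`cmSignConv`: under `ι₁` the profile (J1) (`nonempty_anyLeviKAKInput_of_signs_left`), elsewhere (J2)
(`nonempty_anyLeviKAKInput_of_signs_right`). [cite: KonnoKonno2007, §3.1 (3.1); MoeglinVignerasWaldspurger1987,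
Ch. 1 I.17; Folland1989, §4.2 (4.24) p. 156, Prop. (4.39); Knapp2002, Thm 7.39] -/
theorem nonempty_anyLeviKAKInput_cmSignConv (ι₁ : L →+* ℂ)
    (h₁V : ∃ i₀ : Fin N, (∀ i, i ≠ i₀ → 0 < (ι₁ (dV i)).re) ∨ ∀ i, i ≠ i₀ → (ι₁ (dV i)).re < 0)
    (h₁W : (∀ j, 0 < (ι₁ (dW j)).re) ∨ ∀ j, (ι₁ (dW j)).re < 0)
    (hV : ∀ τ : L →+* ℂ, InfinitePlace.mk τ ≠ InfinitePlace.mk ι₁ →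
      (∀ i, 0 < (τ (dV i)).re) ∨ ∀ i, (τ (dV i)).re < 0)
    (hW : ∀ τ : L →+* ℂ, InfinitePlace.mk τ ≠ InfinitePlace.mk ι₁ →
      (∃ j₀ : Fin M, ∀ j, j ≠ j₀ → 0 < (τ (dW j)).re) ∨ ∀ j, (τ (dW j)).re < 0)
    (v : {v : InfinitePlace ↥(maximalRealSubfield L) // v.IsReal}) :
    Nonempty (AnyLeviKAKInput
      (γ𝕎[PosIdx (placeSignVec (cmRealVec L dV hdV) (cmSignConv L dV ι₁) v),
        NegIdx (placeSignVec (cmRealVec L dV hdV) (cmSignConv L dV ι₁) v),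
        PosIdx (placeSignVec (cmRealVec L dW hdW) (fun v =>
          ((cmPlaceOver L v).1.embedding (GelbartRogawski1991.UnitaryDualPair.imagUnit L)).im /
            cmSignConv L dV ι₁ v) v),
        NegIdx (placeSignVec (cmRealVec L dW hdW) (fun v =>
          ((cmPlaceOver L v).1.embedding (GelbartRogawski1991.UnitaryDualPair.imagUnit L)).im /
            cmSignConv L dV ι₁ v) v)])) := by
  have him := im_embedding_cmPlaceOver_imagUnit_ne_zero L v
  have hc0 := cmSignConv_ne_zero L dV ι₁ v
  by_cases hv : v.1 = (InfinitePlace.mk ι₁).comap (algebraMap (↥(maximalRealSubfield L)) L)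
  · have hτ : (InfinitePlace.mk ι₁).comap (algebraMap (↥(maximalRealSubfield L)) L) = v.1 := hv.symm
    obtain ⟨i₀, hs⟩ : ∃ i₀ : Fin N, ∀ i, i ≠ i₀ → 0 < (ι₁ (dV i)).re / cmSignConv L dV ι₁ v := by
      by_cases hpos : ∃ i₀ : Fin N, ∀ i, i ≠ i₀ → 0 < (ι₁ (dV i)).re
      · have hc : cmSignConv L dV ι₁ v = 1 := by rw [cmSignConv, if_pos hv, if_pos hpos]
        obtain ⟨i₀, h⟩ := hpos
        exact ⟨i₀, fun i hi => by rw [hc, div_one]; exact h i hi⟩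
      · have hc : cmSignConv L dV ι₁ v = -1 := by rw [cmSignConv, if_pos hv, if_neg hpos]
        rcases h₁V with ⟨i₀, h | h⟩
        · exact absurd ⟨i₀, h⟩ hpos
        · exact ⟨i₀, fun i hi => by rw [hc, div_neg, div_one, neg_pos]; exact h i hi⟩
    refine nonempty_anyLeviKAKInput_of_signs_left i₀ (fun i hi => ?_) ?_
    · rw [placeSignVec_cmRealVec L v ι₁ hτ]; exact hs i hi
    · refine (forall_pos_or_forall_neg_div h₁W (div_ne_zero him hc0)).imp (fun h j => ?_) fun h j => ?_ <;>
        rw [placeSignVec_cmRealVec L v ι₁ hτ] <;> exact h j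
  · have hτ : (InfinitePlace.mk (cmPlaceOver L v).1.embedding).comap (algebraMap (↥(maximalRealSubfield L)) L) =
        v.1 := by
      rw [mk_embedding]; exact cmPlaceOver_comap L v
    have hne : InfinitePlace.mk (cmPlaceOver L v).1.embedding ≠ InfinitePlace.mk ι₁ := by
      intro h; apply hv; rw [← h, mk_embedding, cmPlaceOver_comap]
    have hc : cmSignConv L dV ι₁ v =
        ((cmPlaceOver L v).1.embedding (GelbartRogawski1991.UnitaryDualPair.imagUnit L)).im := by
      rw [cmSignConv, if_neg hv]
    refine nonempty_anyLeviKAKInput_of_signs_right ?_ ?_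
    · refine (forall_pos_or_forall_neg_div (hV _ hne) him).imp (fun h i => ?_) fun h i => ?_ <;>
        rw [placeSignVec_cmRealVec L v _ hτ, hc] <;> exact h i
    · refine (hW _ hne).imp (fun h => h.imp fun j₀ h j hj => ?_) fun h j => ?_ <;>
        rw [placeSignVec_cmRealVec L v _ hτ, hc, div_self him, div_one] <;> first | exact h j hj | exact h j

/-- **The CM pin from SIGN FACTS through complex embeddings — the consumer's form (no frames, no scalings, no
`KAK` data).**  Fix a complex embedding `ι₁` of the CM field `L`.  Suppose that through `ι₁` all but one of the
(real, non-zero) numbers `ι₁(d_V i)` have a common strict sign and the `ι₁(d_W j)` have a common strict sign — the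
real pair at the place under `ι₁` is `U(N−1,1) × U(M,0)` up to orientation (`LeviKAKInput.junction`) — and that
through every complex embedding `τ` at another place the `τ(d_V i)` have a common strict sign and all but at most
one of the `τ(d_W j)` are positive, or all are negative — `U(N,0) × U(M−1,1)` / compact (`LeviKAKInput.junctionSwap`,
`.junctionCompact`).  Then `(u₁, u₂) ↦ ω_ψ(s_pair(u₁, u₂))` `HasThetaMajorants` — the hypothesis `hρ` of
`GelbartRogawski1991.UnitaryDualPair.cmThetaKernelDatum`, verbatim (sign convention `cmSignConv`).
[cite: Weil1964, Chap. III n° 41 Lemme 5 p. 194, Théorème 6 (1) p. 193; GelbartRogawski1991, §3.1 Prop. 3.1.1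
p. 455; KonnoKonno2007, §3.1 (3.1); MoeglinVignerasWaldspurger1987, Ch. 1 I.17; Folland1989, §4.2 (4.24) p. 156,
Prop. (4.39); Knapp2002, Thm 7.39] -/
theorem hasThetaMajorants_cmPairSplitting_of_signs (ι₁ : L →+* ℂ)
    (hGR : (GelbartRogawski1991.UnitaryDualPair.cmSplittingDatum L e dV hdV hdV0 dW hdW hdW0).CompatibleSplitting)
    (h₁V : ∃ i₀ : Fin N, (∀ i, i ≠ i₀ → 0 < (ι₁ (dV i)).re) ∨ ∀ i, i ≠ i₀ → (ι₁ (dV i)).re < 0)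
    (h₁W : (∀ j, 0 < (ι₁ (dW j)).re) ∨ ∀ j, (ι₁ (dW j)).re < 0)
    (hV : ∀ τ : L →+* ℂ, InfinitePlace.mk τ ≠ InfinitePlace.mk ι₁ →
      (∀ i, 0 < (τ (dV i)).re) ∨ ∀ i, (τ (dV i)).re < 0)
    (hW : ∀ τ : L →+* ℂ, InfinitePlace.mk τ ≠ InfinitePlace.mk ι₁ →
      (∃ j₀ : Fin M, ∀ j, j ≠ j₀ → 0 < (τ (dW j)).re) ∨ ∀ j, (τ (dW j)).re < 0) :
    HasThetaMajorants fun
      (p : ↥(UnitaryGroup.adelic (↥(maximalRealSubfield L)) L (IsCMField.complexConj L) N (Matrix.diagonal dV)) ×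
        ↥(UnitaryGroup.adelic (↥(maximalRealSubfield L)) L (IsCMField.complexConj L) M (Matrix.diagonal dW)))
      (Φ : piSchwartzBruhat (↥(maximalRealSubfield L)) (Fin n)) =>
        adelicMpCont.omega (↥(maximalRealSubfield L)) (Fin n)
          (GelbartRogawski1991.UnitaryDualPair.adelicGram (↥(maximalRealSubfield L)) e
            (GelbartRogawski1991.UnitaryDualPair.realDiagonal L dV hdV)
            (GelbartRogawski1991.UnitaryDualPair.realDiagonal L dW hdW))
          (GelbartRogawski1991.UnitaryDualPair.cmPairSplitting L e dV hdV hdV0 dW hdW hdW0 hGR p) Φ :=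
  hasThetaMajorants_cmPairSplitting_canonical L e dV hdV hdV0 dW hdW hdW0 (cmSignConv L dV ι₁)
    (cmSignConv_ne_zero L dV ι₁) hGR (nonempty_anyLeviKAKInput_cmSignConv L dV hdV dW hdW ι₁ h₁V h₁W hV hW)

end CM

section CMPlane

variable (L : Type) [Field L] [NumberField L] [IsCMField L]

/-- a conjugation-fixed non-zero element of the CM field is a non-zero REAL number through every complex
embedding: `re τ(x) ≠ 0`. [folklore] -/
theorem re_apply_ne_zero_of_complexConj_eq (τ : L →+* ℂ) {x : L} (hx : IsCMField.complexConj L x = x)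
    (hx0 : x ≠ 0) : (τ x).re ≠ 0 := by
  have h : τ x = _ := embedding_algebraMap_eq_embedding_of_isReal L
    ⟨(InfinitePlace.mk τ).comap (algebraMap (↥(maximalRealSubfield L)) L), IsTotallyReal.isReal _⟩ τ rfl
    ⟨x, (IsCMField.complexConj_eq_self_iff (K := L) x).1 hx⟩
  intro hr
  apply (map_ne_zero τ).2 hx0
  rw [h, Complex.ofReal_re] at hr
  rw [h, hr, Complex.ofReal_zero]

omit [NumberField L] [IsCMField L] in
/-- two non-zero reals: all but at most one of them are positive, or both are negative. [folklore] -/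
theorem signs_fin_two {y : Fin 2 → ℝ} (hy : ∀ j, y j ≠ 0) :
    (∃ j₀ : Fin 2, ∀ j, j ≠ j₀ → 0 < y j) ∨ ∀ j, y j < 0 := by
  by_cases h0 : 0 < y 0
  · exact Or.inl ⟨1, Fin.forall_fin_two.2 ⟨fun _ => h0, fun h => absurd rfl h⟩⟩
  by_cases h1 : 0 < y 1
  · exact Or.inl ⟨0, Fin.forall_fin_two.2 ⟨fun h => absurd rfl h, fun _ => h1⟩⟩
  exact Or.inr (Fin.forall_fin_two.2 ⟨lt_of_le_of_ne (not_lt.1 h0) (hy 0), lt_of_le_of_ne (not_lt.1 h1) (hy 1)⟩)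

variable {N n : ℕ} (e : Fin N × Fin 2 ≃ Fin n)
  (dV : Fin N → L) (hdV : ∀ i, IsCMField.complexConj L (dV i) = dV i) (hdV0 : ∀ i, dV i ≠ 0)
  (dW : Fin 2 → L) (hdW : ∀ i, IsCMField.complexConj L (dW i) = dW i) (hdW0 : ∀ i, dW i ≠ 0)

/-- **The CM pin for a hermitian PLANE `W = ⟨d_W 0⟩ ⊕ ⟨d_W 1⟩`** (`M = 2`; the pub-hodgecm model's `U(V) × U(W₁ ⊕ W₂)`,
`N = 3`): away from the distinguished embedding `ι₁` NO hypothesis on `W` is needed (`signs_fin_two`), so the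
input is: `V` of signature `(N−1,1)` or `(1,N−1)` and `W` definite through `ι₁`, `V` definite through every other
embedding. [cite: Weil1964, Chap. III n° 41 Lemme 5 p. 194, Théorème 6 (1) p. 193; GelbartRogawski1991, §3.1
Prop. 3.1.1 p. 455; KonnoKonno2007, §3.1 (3.1); MoeglinVignerasWaldspurger1987, Ch. 1 I.17; Folland1989, §4.2
(4.24) p. 156, Prop. (4.39); Knapp2002, Thm 7.39] -/
theorem hasThetaMajorants_cmPairSplitting_of_signs_two (ι₁ : L →+* ℂ)
    (hGR : (GelbartRogawski1991.UnitaryDualPair.cmSplittingDatum L e dV hdV hdV0 dW hdW hdW0).CompatibleSplitting)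
    (h₁V : ∃ i₀ : Fin N, (∀ i, i ≠ i₀ → 0 < (ι₁ (dV i)).re) ∨ ∀ i, i ≠ i₀ → (ι₁ (dV i)).re < 0)
    (h₁W : (∀ j, 0 < (ι₁ (dW j)).re) ∨ ∀ j, (ι₁ (dW j)).re < 0)
    (hV : ∀ τ : L →+* ℂ, InfinitePlace.mk τ ≠ InfinitePlace.mk ι₁ →
      (∀ i, 0 < (τ (dV i)).re) ∨ ∀ i, (τ (dV i)).re < 0) :
    HasThetaMajorants fun
      (p : ↥(UnitaryGroup.adelic (↥(maximalRealSubfield L)) L (IsCMField.complexConj L) N (Matrix.diagonal dV)) ×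
        ↥(UnitaryGroup.adelic (↥(maximalRealSubfield L)) L (IsCMField.complexConj L) 2 (Matrix.diagonal dW)))
      (Φ : piSchwartzBruhat (↥(maximalRealSubfield L)) (Fin n)) =>
        adelicMpCont.omega (↥(maximalRealSubfield L)) (Fin n)
          (GelbartRogawski1991.UnitaryDualPair.adelicGram (↥(maximalRealSubfield L)) e
            (GelbartRogawski1991.UnitaryDualPair.realDiagonal L dV hdV)
            (GelbartRogawski1991.UnitaryDualPair.realDiagonal L dW hdW))
          (GelbartRogawski1991.UnitaryDualPair.cmPairSplitting L e dV hdV hdV0 dW hdW hdW0 hGR p) Φ :=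
  hasThetaMajorants_cmPairSplitting_of_signs L e dV hdV hdV0 dW hdW hdW0 ι₁ hGR h₁V h₁W hV fun τ _ =>
    signs_fin_two fun j => re_apply_ne_zero_of_complexConj_eq L τ (hdW j) (hdW0 j)

end CMPlane

/-! ### Build-lane note (ops-buildfix G11b-3 recipe, LEDGER B13-1, 2026-08-21)
`lean -o` (the hub build lane, never `lean`/the gate check) runs Lean 4.32's library-suggestion indexers
(`Lean.LibrarySuggestions.SymbolFrequency` / `SineQuaNon`, from their `exportEntriesFn`) over the statement of
every local theorem that is not a denied premise; on this family's statements (very large dependent binder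
telescopes through the theta-kernel / dual-pair data) that fold runs for tens of minutes to hours and the build
lane kills the job (incident G11b-3, run/shared/lean/ops/buildfix/G11b-3-DOSSIER.md). `isDeniedPremise` skips
`[implicit_reducible]` constants before any fold, and a reducibility status on a *theorem* is inert (Meta never
unfolds `thmInfo`; the kernel ignores the attribute), so the public theorems of this file are tagged
`[implicit_reducible]` purely to keep them out of that index. Only other effect: they are not offered by
`+suggestions` premise selectors. No statement or proof is changed; superseded if the operator lands a
deny-list form (`HarnessLib.PremiseIndex`). -/
set_option allowUnsafeReducibility true in
attribute [implicit_reducible]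
  nonempty_anyLeviKAKInput_of_card_le_one nonempty_anyLeviKAKInput_of_compact_left
  signOf_signSplit_mul_abs sqrtAbs_sq sqrtAbs_ne_zero eq_mul_signOf_signSplit_mul_sqrtAbs_sq
  isEmpty_negIdx isEmpty_posIdx card_negIdx_le_one card_posIdx_le_one
  ne_zero_of_isUnit_det_diagonal nonempty_anyLeviKAKInput_of_signs_left
  nonempty_anyLeviKAKInput_of_signs_right archPhaseMap_toSp_pair
  hasThetaMajorants_omega_pairSplitting hasThetaMajorants_omega_pairSplitting_of_nonempty
  hasThetaMajorants_omega_pairSplitting_canonical cmPlaceOver_smul cmPlaceOver_comap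
  realDiagonal_eq_diagonal embedding_algebraMap_eq_embedding_of_isReal cmPlaceOver_eq_mk
  im_embedding_cmPlaceOver_eq_or im_embedding_cmPlaceOver_imagUnit_ne_zero
  embedding_of_isReal_cmRealVec placeSignVec_cmRealVec hasThetaMajorants_cmPairSplitting
  hasThetaMajorants_cmPairSplitting_of_nonempty hasThetaMajorants_cmPairSplitting_canonical
  forall_pos_or_forall_neg_div cmSignConv_ne_zero nonempty_anyLeviKAKInput_cmSignConv
  hasThetaMajorants_cmPairSplitting_of_signs re_apply_ne_zero_of_complexConj_eq signs_fin_two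
  hasThetaMajorants_cmPairSplitting_of_signs_two

end Literature.NumberTheory.Weil1964
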